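import Summits.Ventures.PercRepro.PuncturedLYMSingleMain

/-!
# PercRepro — THE PUNCTURED NORMALISED MATCHING PROPERTY FOR ONE CO-HYPERPLANE OF ANY SIZE, PART 1: THE RADIAL
WEIGHTS, THEIR ROW AND COLUMN SUMS, AND THE REDUCTION TO TWO SEQUENCES (p10, gen 33)

Let `C` be a set of `m` points (`1 ≤ m ≤ j`) and `D = upLevel j C` the `j`-sets containing `C` — the co-code of the
paving matroid of rank `r = n − j` whose only nontrivial hyperplane is `univ ∖ C` (its dependent `r`-sets are the
`r`-subsets of `univ ∖ C`, their complements the `j`-sets containing `C`).  The punctured level `P` consists of the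
`j`-sets `X` with `C ⊄ X`; write `c(X) = #(X ∩ C) ≤ m − 1`.  For `m = j` this is the single-word code `{C}` of
PuncturedLYMSingle.

Given two sequences `xv yv : ℕ → ℚ` the RADIAL WEIGHT of the completion `X ↦ X ∪ y` is `yv (c X)` when `y ∈ C` and
`xv (c X)` when `y ∉ C` (`hW`, `hWp`).
* `sum_sups_hW` — the ROW SUM at `X ∈ P` is `(m − c)·yv c + (n − j − m + c)·xv c` (`c = c(X)`: `m − c` completing
  points lie in `C`, `n − j − m + c` outside `C`);
* `sum_subsP_hW_lt`, `sum_subsP_hW_top` — the COLUMN SUM at a `(j+1)`-set `Y` with `c' = #(Y ∩ C) < m` (all its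
  `j`-subsets lie in `P`) is `c'·yv (c' − 1) + (j + 1 − c')·xv c'`, and at a `(j+1)`-set containing `C` (the
  `P`-subsets are the `Y ∖ z`, `z ∈ C`) it is `m·yv (m − 1)`;
* **`puncturedNMP_upLevel_of_seq`** — (SP) for `upLevel j C` whenever the sequences are nonnegative, the row sums are
  `1` and the column sums are `k = #P/#Y`: the weights scaled by `k` have row sums `#Y/#P` and column sums `1`, and
  the master lemma `puncturedNMP_of_weights` finishes.
The explicit sequences (the exact solution of the recursion, nonnegative for `2j + 1 ≤ n`) are PuncturedLYMCoHypSeq;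
the theorem for every `C` is PuncturedLYMCoHypMain.  Nothing here asserts (SP).
-/

namespace PercRepro.PuncturedLYM

open Finset

variable {α : Type} [Fintype α] [DecidableEq α]

/-! ### The family of `j`-sets containing `C` -/

/-- The `j`-sets containing `C`. -/
def upLevel (j : ℕ) (C : Finset α) : Finset (Finset α) :=
  ((univ : Finset α).powersetCard j).filter (fun X => C ⊆ X)

/-- Membership in `upLevel`. -/
theorem mem_upLevel {j : ℕ} {C X : Finset α} : X ∈ upLevel j C ↔ X.card = j ∧ C ⊆ X := by
  simp [upLevel, mem_powersetCard]

/-- Membership in `P` for `upLevel j C`: the `j`-sets not containing `C`. -/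
theorem mem_punctured_upLevel {j : ℕ} {C X : Finset α} :
    X ∈ punctured j (upLevel j C) ↔ X.card = j ∧ ¬ C ⊆ X := by
  rw [mem_punctured, mem_upLevel]
  constructor
  · rintro ⟨hX, h⟩
    exact ⟨hX, fun hC => h ⟨hX, hC⟩⟩
  · rintro ⟨hX, h⟩
    exact ⟨hX, fun hC => h hC.2⟩

omit [Fintype α] in
/-- `c(X) = #(X ∩ C) ≤ m − 1` for `X ∈ P` (`C ⊄ X`, `m = #C`). -/
theorem aOf_lt_card {C X : Finset α} (h : ¬ C ⊆ X) : aOf C X < C.card := by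
  unfold aOf
  by_contra hc
  have h1 : (X ∩ C).card = C.card := le_antisymm (card_le_card inter_subset_right) (not_lt.1 hc)
  have h2 : X ∩ C = C := eq_of_subset_of_card_le inter_subset_right (by omega)
  exact h (h2 ▸ inter_subset_left)

/-! ### The radial weights -/

/-- The weight of the completion `X ↦ insert y X`: `yv (c X)` inside `C`, `xv (c X)` outside. -/
def hW (xv yv : ℕ → ℚ) (C X : Finset α) (y : α) : ℚ :=
  if y ∈ C then yv (aOf C X) else xv (aOf C X)

/-- The radial weights on a pair `(X, Y)`: `hW` at the point of `Y ∖ X`. -/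
def hWp (xv yv : ℕ → ℚ) (C X Y : Finset α) : ℚ :=
  ∑ y ∈ Y \ X, hW xv yv C X y

omit [Fintype α] in
/-- `hWp X (insert y X) = hW X y` for `y ∉ X`. -/
theorem hWp_insert (xv yv : ℕ → ℚ) (C X : Finset α) {y : α} (hy : y ∉ X) :
    hWp xv yv C X (insert y X) = hW xv yv C X y := by
  unfold hWp
  have h : insert y X \ X = {y} := by
    ext z
    simp only [mem_sdiff, mem_insert, mem_singleton]
    constructor
    · rintro ⟨h1, h2⟩
      exact h1.resolve_right h2
    · rintro rfl
      exact ⟨Or.inl rfl, hy⟩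
  rw [h, sum_singleton]

/-! ### Row sums -/

/-- **The row sum at a `j`-set `X`** is `(m − c)·yv c + (n − j − m + c)·xv c` with `c = c(X)`, `m = #C`. -/
theorem sum_sups_hW {j : ℕ} (xv yv : ℕ → ℚ) {C X : Finset α} (hX : X.card = j) :
    ∑ Y ∈ sups j X, hWp xv yv C X Y =
      ((C.card : ℚ) - aOf C X) * yv (aOf C X) +
        ((Fintype.card α : ℚ) - j - C.card + aOf C X) * xv (aOf C X) := by
  rw [sum_sups hX]
  have h1 : ∀ y ∈ univ \ X, hWp xv yv C X (insert y X) = hW xv yv C X y :=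
    fun y hy => hWp_insert xv yv C X (mem_sdiff.1 hy).2
  rw [sum_congr rfl h1]
  unfold hW
  rw [sum_ite, sum_const, sum_const, nsmul_eq_mul, nsmul_eq_mul]
  have hCX : (univ \ X).filter (fun y => y ∈ C) = C \ X := by
    ext y
    simp only [mem_filter, mem_sdiff, mem_univ, true_and]
    tauto
  have hCX' : (univ \ X).filter (fun y => ¬ y ∈ C) = univ \ (X ∪ C) := by
    ext y
    simp only [mem_filter, mem_sdiff, mem_univ, true_and, mem_union, not_or]
  rw [hCX, hCX', card_univ_sdiff]
  have hc1 := card_sdiff_B (X := X) (B := C) rfl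
  have hc2 := card_union_B C X
  rw [hX] at hc2
  have hXC : (X ∪ C).card ≤ Fintype.card α := card_le_univ _
  have ha : aOf C X ≤ C.card := by omega
  have e1 : ((C \ X).card : ℚ) = C.card - aOf C X := by
    have : (C \ X).card = C.card - aOf C X := by omega
    rw [this, Nat.cast_sub ha]
  have e2 : ((Fintype.card α - (X ∪ C).card : ℕ) : ℚ) = (Fintype.card α : ℚ) - j - C.card + aOf C X := by
    rw [Nat.cast_sub hXC]
    have : ((X ∪ C).card : ℚ) = j + C.card - aOf C X := by
      have : (X ∪ C).card = j + C.card - aOf C X := by omega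
      rw [this, Nat.cast_sub (by omega)]
      push_cast
      ring
    rw [this]
    ring
  rw [e1, e2]

/-! ### Column sums -/

/-- The `P`-subsets of a `(j+1)`-set `Y` with `C ⊄ Y` are all its `j`-subsets `Y.erase z`. -/
theorem subsP_upLevel_eq_image_erase {j : ℕ} {C Y : Finset α} (hY : Y.card = j + 1) (hCY : ¬ C ⊆ Y) :
    subsP j (upLevel j C) Y = Y.image (fun z => Y.erase z) := by
  ext X
  simp only [mem_subsP, mem_image, mem_upLevel]
  constructor
  · rintro ⟨⟨hXc, -⟩, hXY⟩
    have h1 : (Y \ X).card = 1 := by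
      rw [card_sdiff_of_subset hXY]
      omega
    obtain ⟨z, hz⟩ := card_eq_one.1 h1
    have hzY : z ∈ Y \ X := hz ▸ mem_singleton_self z
    rw [mem_sdiff] at hzY
    refine ⟨z, hzY.1, ?_⟩
    symm
    apply eq_of_subset_of_card_le
    · intro w hw
      rw [mem_erase]
      refine ⟨?_, hXY hw⟩
      rintro rfl
      exact hzY.2 hw
    · rw [card_erase_of_mem hzY.1, hY, hXc, Nat.add_sub_cancel]
  · rintro ⟨z, hzY, rfl⟩
    refine ⟨⟨by rw [card_erase_of_mem hzY, hY, Nat.add_sub_cancel], ?_⟩, erase_subset z Y⟩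
    rintro ⟨-, hC⟩
    exact hCY (hC.trans (erase_subset z Y))

/-- **The column sum at a `(j+1)`-set `Y` with `c' = #(Y ∩ C) < m`** is `c'·yv (c' − 1) + (j + 1 − c')·xv c'`. -/
theorem sum_subsP_hW_lt {j : ℕ} (xv yv : ℕ → ℚ) {C Y : Finset α} (hY : Y.card = j + 1) (hCY : ¬ C ⊆ Y) :
    ∑ X ∈ subsP j (upLevel j C) Y, hWp xv yv C X Y =
      ((Y ∩ C).card : ℚ) * yv ((Y ∩ C).card - 1) + ((j : ℚ) + 1 - (Y ∩ C).card) * xv (Y ∩ C).card := by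
  rw [subsP_upLevel_eq_image_erase hY hCY, sum_image (erase_injOn Y)]
  have h1 : ∀ z ∈ Y, hWp xv yv C (Y.erase z) Y =
      if z ∈ C then yv ((Y ∩ C).card - 1) else xv (Y ∩ C).card := by
    intro z hz
    unfold hWp
    rw [sdiff_erase_eq_singleton hz, sum_singleton]
    unfold hW
    have hk := aOf_erase C hz
    split_ifs with hzC
    · rw [if_pos hzC] at hk
      have : aOf C (Y.erase z) = (Y ∩ C).card - 1 := by omega
      rw [this]
    · rw [if_neg hzC, add_zero] at hk
      rw [hk]
  rw [sum_congr rfl h1, sum_ite, sum_const, sum_const, nsmul_eq_mul, nsmul_eq_mul]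
  have hk1 : (Y.filter (fun z => z ∈ C)).card = (Y ∩ C).card := by rw [filter_mem_eq_inter]
  have hk2 : (Y.filter (fun z => ¬ z ∈ C)).card = j + 1 - (Y ∩ C).card := by
    have := card_filter_add_card_filter_not (fun z => z ∈ C) (s := Y)
    rw [hY] at this
    omega
  have hYC : (Y ∩ C).card ≤ j + 1 := hY ▸ card_le_card inter_subset_left
  rw [hk1, hk2, Nat.cast_sub hYC]
  push_cast
  ring

/-- **The column sum at a `(j+1)`-set containing `C`** is `m·yv (m − 1)`. -/
theorem sum_subsP_hW_top {j : ℕ} (xv yv : ℕ → ℚ) {C Y : Finset α} (hY : Y.card = j + 1) (hCY : C ⊆ Y) :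
    ∑ X ∈ subsP j (upLevel j C) Y, hWp xv yv C X Y = (C.card : ℚ) * yv (C.card - 1) := by
  -- the `P`-subsets are the `Y.erase z`, `z ∈ C`
  have hsub : subsP j (upLevel j C) Y = C.image (fun z => Y.erase z) := by
    ext X
    simp only [mem_subsP, mem_image, mem_upLevel]
    constructor
    · rintro ⟨⟨hXc, hXD⟩, hXY⟩
      have h1 : (Y \ X).card = 1 := by
        rw [card_sdiff_of_subset hXY]
        omega
      obtain ⟨z, hz⟩ := card_eq_one.1 h1
      have hzY : z ∈ Y \ X := hz ▸ mem_singleton_self z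
      rw [mem_sdiff] at hzY
      have hXe : X = Y.erase z := by
        apply eq_of_subset_of_card_le
        · intro w hw
          rw [mem_erase]
          refine ⟨?_, hXY hw⟩
          rintro rfl
          exact hzY.2 hw
        · rw [card_erase_of_mem hzY.1, hY, hXc, Nat.add_sub_cancel]
      refine ⟨z, ?_, hXe.symm⟩
      -- if `z ∉ C` then `C ⊆ Y.erase z = X`, so `X ∈ D`
      by_contra hzC
      apply hXD
      refine ⟨hXc, ?_⟩
      rw [hXe]
      intro w hw
      rw [mem_erase]
      exact ⟨fun h => hzC (h ▸ hw), hCY hw⟩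
    · rintro ⟨z, hzC, rfl⟩
      refine ⟨⟨by rw [card_erase_of_mem (hCY hzC), hY, Nat.add_sub_cancel], ?_⟩, erase_subset z Y⟩
      rintro ⟨-, hC⟩
      have := hC hzC
      rw [mem_erase] at this
      exact this.1 rfl
  rw [hsub, sum_image (erase_injOn Y |>.mono (coe_subset.2 hCY))]
  have h1 : ∀ z ∈ C, hWp xv yv C (Y.erase z) Y = yv (C.card - 1) := by
    intro z hz
    unfold hWp
    rw [sdiff_erase_eq_singleton (hCY hz), sum_singleton]
    unfold hW
    rw [if_pos hz]
    have hk := aOf_erase C (hCY hz)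
    rw [if_pos hz] at hk
    have hYC : Y ∩ C = C := inter_eq_right.2 hCY
    rw [hYC] at hk
    have : aOf C (Y.erase z) = C.card - 1 := by omega
    rw [this]
  rw [sum_congr rfl h1, sum_const, nsmul_eq_mul]

/-! ### The reduction to two sequences -/

/-- **(SP) for `upLevel j C` from two sequences** with nonnegative terms, row sums `1` and column sums
`k = #P/#Y` (`m = #C`, `j < n`):
`(m − c)·yv c + (n − j − m + c)·xv c = 1` for `c < m`; `(j + 1)·xv 0 = k`;
`c'·yv (c' − 1) + (j + 1 − c')·xv c' = k` for `1 ≤ c' < m`; `m·yv (m − 1) = k`. -/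
theorem puncturedNMP_upLevel_of_seq {j : ℕ} {C : Finset α} (hjn : j < Fintype.card α)
    (xv yv : ℕ → ℚ) (k : ℚ)
    (hk : k * (levelAbove α j).card = (punctured j (upLevel j C)).card)
    (hnn : ∀ c, c < C.card → 0 ≤ xv c ∧ 0 ≤ yv c)
    (hrow : ∀ c, c < C.card →
      ((C.card : ℚ) - c) * yv c + ((Fintype.card α : ℚ) - j - C.card + c) * xv c = 1)
    (hcol0 : ((j : ℚ) + 1) * xv 0 = k)
    (hcol : ∀ c', 1 ≤ c' → c' < C.card → (c' : ℚ) * yv (c' - 1) + ((j : ℚ) + 1 - c') * xv c' = k)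
    (htop : (C.card : ℚ) * yv (C.card - 1) = k) :
    PuncturedNMP j (upLevel j C) := by
  intro 𝒜 h𝒜
  rcases Nat.eq_zero_or_pos (punctured j (upLevel j C)).card with hP | hP
  · have : 𝒜 = ∅ := subset_empty.1 (card_eq_zero.1 hP ▸ h𝒜)
    subst this
    simp
  have hYpos : (0 : ℚ) < (levelAbove α j).card := by exact_mod_cast card_levelAbove_pos hjn
  have hPpos : (0 : ℚ) < (punctured j (upLevel j C)).card := by exact_mod_cast hP
  have hkpos : 0 < k := by
    by_contra h
    push Not at h
    have : k * (levelAbove α j).card ≤ 0 := mul_nonpos_of_nonpos_of_nonneg h hYpos.le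
    linarith
  refine puncturedNMP_of_weights (fun X Y => hWp xv yv C X Y / k) ?_ ?_ ?_ 𝒜 h𝒜
  · -- nonnegativity
    intro X hX Y hY
    obtain ⟨hXc, hCX⟩ := mem_punctured_upLevel.1 hX
    rw [sups_eq hXc] at hY
    obtain ⟨y, hy, rfl⟩ := mem_image.1 hY
    rw [hWp_insert xv yv C X (mem_sdiff.1 hy).2]
    apply div_nonneg _ hkpos.le
    unfold hW
    have hc := aOf_lt_card hCX
    split_ifs
    · exact (hnn _ hc).2
    · exact (hnn _ hc).1
  · -- row sums
    intro X hX
    obtain ⟨hXc, hCX⟩ := mem_punctured_upLevel.1 hX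
    rw [← sum_div, sum_sups_hW xv yv hXc, hrow _ (aOf_lt_card hCX)]
    rw [div_le_div_iff₀ hPpos hkpos, one_mul, ← hk]
    exact le_of_eq (mul_comm _ _)
  · -- column sums
    intro Y hY
    rw [mem_levelAbove] at hY
    rw [← sum_div, div_le_one hkpos]
    by_cases hCY : C ⊆ Y
    · rw [sum_subsP_hW_top xv yv hY hCY, htop]
    · rw [sum_subsP_hW_lt xv yv hY hCY]
      have hYC : (Y ∩ C).card < C.card := by
        by_contra h
        push Not at h
        have h1 : (Y ∩ C).card = C.card := le_antisymm (card_le_card inter_subset_right) h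
        have h2 : Y ∩ C = C := eq_of_subset_of_card_le inter_subset_right (by omega)
        exact hCY (h2 ▸ inter_subset_left)
      rcases Nat.eq_zero_or_pos (Y ∩ C).card with h0 | h0
      · rw [h0]
        push_cast
        rw [zero_mul, zero_add, sub_zero, hcol0]
      · rw [hcol _ h0 hYC]

end PercRepro.PuncturedLYM
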